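import Literature.Probability.Percolation.DecisionTreeWeighted
import Mathlib.Algebra.BigOperators.Group.Finset.Powerset
import Mathlib.Tactic.Linarith
import Mathlib.Tactic.Ring
import HarnessLib

/-!
# The degree-3 Gladkov–Zimin lift: cubic kernel rows for monotone-labelled product measures

Topic `Literature/Probability/Percolation`, weighted-cube language of `DecisionTreeWeighted.lean`
(`wtW D p S`, configurations `S ⊆ D`, fibre masses `PrW D p {S | π S = a}`); companion of
`GladkovZiminCompletePositivity.lean` (degree 2 = the draft's Thm 4.3).  Self-contained over
`DecisionTreeWeighted.lean`.

## Source and what is new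

N. Gladkov, A. Zimin, *On Harris–Kleitman type inequalities*, unpublished draft (September 2024)
[GladkovZimin2024HK], §5 "Inequalities of degree at least 3" states a `k`-copy theorem (Thm 5.1:
`E_{μ^k} g(x₁,…,x_k) ≥ E_μ g(x,…,x)` under a `k`-variable exchange condition (12)) and stops at
"Proof." — no proof and no description of the resulting cone are printed.  This file proves the
`k = 3` statement in the form that the one-coordinate induction actually yields, with an explicit,
kernel-checkable sufficient condition.  Writing `x` for the label law of a monotone labelling `π`,
`diag₃(x) = Σ_a x_a e_a^{⊗3}`, and exposing one coordinate of weight `q` (`x = (1−q)x⁰ + q x¹`,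
`Δ = x¹ − x⁰` a nonnegative combination of monotone differences), the cubic analogue of the draft's
(9) is the identity

  `(1−q)·x⁰^{⊗3} + q·x¹^{⊗3} − x^{⊗3} = q(1−q)·[ (2−q)·Sym(x⁰⊗Δ⊗Δ) + (1+q)·Sym(x¹⊗Δ⊗Δ) ]`,

both coefficients nonnegative; hence `diag₃(x) − x^{⊗3}` lies in the cone generated by the tensors
`Sym(y ⊗ d ⊗ d)` with `y ≥ 0` and `d` a nonnegative combination of monotone differences, and every
SYMMETRIC cubic kernel `A` whose SLICES `A(y,·,·)` all satisfy the degree-2 pair-dominance condition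
(e.g. slice pair kernels = Gram + nonnegative) gives the valid cubic row
`Σ_{a,b,c} A a b c · x_a x_b x_c ≤ Σ_a A a a a · x_a`.

* `sum3_wtW_le_sum_wtW_diag3_of_slicePairDominance` — configuration form, by the printed style of
  induction on coordinates (8 sections of the three-copy sum; the identity above with `X₀,…,X₃`).
* `slicePairDominance_of_gram` — the checkable sufficient condition (per-slice Gram + nonnegative pair
  kernel ⟹ slice pair dominance; a sum of squares plus a nonnegative sum, weighted by the slice law).
* `cubicKernel_PrW_fiber_le_of_gram` — the row on the label law `x_a = PrW D p {S | π S = a}`.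

Project use: a cubic row family for the degree-3 certificate searches of
`Summits/CriticalPhenomena/PercolationContinuityZ3` (crux `NoHeavyLowerTail`; memo
`run/shared/lean/prim/prim-lf-7/DNN-LIFT.md` §6), where genuinely cubic valid rows were absent.

## References

* N. Gladkov, A. Zimin, *On Harris–Kleitman type inequalities*, unpublished draft, September 2024, §4
  (Thm 4.3, the degree-2 lift) and §5 (Thm 5.1, statement only). [GladkovZimin2024HK]
-/

noncomputable section

namespace Literature.Probability.Percolation

namespace DecisionTree

open Finset

variable {ι : Type*} [DecidableEq ι]

/-- One-coordinate decomposition of a weighted sum (local copy for this file):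
`Σ_{S ⊆ insert e D} w S · φ S = (1 - p_e) Σ_{S ⊆ D} w S · φ S + p_e Σ_{S ⊆ D} w S · φ (insert e S)`.
[cite: GladkovZimin2024HK, proof of Thm. 4.3 (§4)] -/
private theorem sum_wtW_insert_split {D : Finset ι} {e : ι} (p : ι → ℝ) (he : e ∉ D)
    (φ : Finset ι → ℝ) :
    ∑ S ∈ (insert e D).powerset, wtW (insert e D) p S * φ S =
      (1 - p e) * ∑ S ∈ D.powerset, wtW D p S * φ S +
        p e * ∑ S ∈ D.powerset, wtW D p S * φ (insert e S) := by
  rw [Finset.sum_powerset_insert he, Finset.mul_sum, Finset.mul_sum]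
  congr 1
  · refine Finset.sum_congr rfl fun S hS => ?_
    have heS : e ∉ S := fun h => he (Finset.mem_powerset.1 hS h)
    have hw : wtW (insert e D) p S = (1 - p e) * wtW D p S := by
      unfold wtW
      rw [Finset.prod_insert he, if_neg heS]
    rw [hw, mul_assoc]
  · refine Finset.sum_congr rfl fun S _ => ?_
    have hw : wtW (insert e D) p (insert e S) = p e * wtW D p S := by
      unfold wtW
      rw [Finset.prod_insert he, if_pos (Finset.mem_insert_self e S)]
      congr 1
      refine Finset.prod_congr rfl fun i hi => ?_
      have hie : i ≠ e := fun h => he (h ▸ hi)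
      simp only [Finset.mem_insert, hie, false_or]
    rw [hw, mul_assoc]

/-! ### The three-copy induction -/

/-- **Degree-3 lift, configuration form.**  Let `A` be a cubic kernel on a preorder, symmetric in its
three arguments, and suppose SLICE PAIR DOMINANCE: for every finite coordinate set `D'`, every
`t`-valued labelling `ρ` and all `t`-valued labellings `σ ≤ τ` (pointwise),
`Σ_S w_S · Σ_{T,U} w_T w_U (A(ρS,σT,τU) + A(ρS,τT,σU)) ≤ Σ_S w_S · Σ_{T,U} w_T w_U (A(ρS,σT,σU) + A(ρS,τT,τU))`
(each slice `A(y,·,·)` satisfies the degree-2 pair-dominance condition, averaged over the slice law).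
Then for every `t`-valued labelling `π` monotone along `⊆`:
`Σ_{S,T,U ⊆ D} w_S w_T w_U · A(πS,πT,πU) ≤ Σ_{S ⊆ D} w_S · A(πS,πS,πS)`.
Proof: induction on the coordinates; with `X_k` the three-copy sections having `k` upper arguments and
`Y₀, Y₁` the diagonal sections, `(1−q)Y₀ + qY₁ ≥ (1−q)X₀ + qX₃` (induction) and
`(1−q)X₀ + qX₃ − Σ_k C(3,k)(1−q)^{3−k}q^k X_k = q(1−q)[(2−q)(X₂ − 2X₁ + X₀) + (1+q)(X₃ − 2X₂ + X₁)] ≥ 0`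
(slice pair dominance with `ρ = π` and `ρ = π ∘ insert e`).
[cite: GladkovZimin2024HK, §5 Thm. 5.1 (k = 3; statement only in the draft — proof supplied here)] -/
theorem sum3_wtW_le_sum_wtW_diag3_of_slicePairDominance (D : Finset ι) {p : ι → ℝ}
    (hp0 : ∀ i, 0 ≤ p i) (hp1 : ∀ i, p i ≤ 1) {κ : Type*} [Preorder κ] (t : Finset κ)
    (A : κ → κ → κ → ℝ) (hA12 : ∀ a b c, A a b c = A b a c) (hA23 : ∀ a b c, A a b c = A a c b)
    (hA : ∀ (D' : Finset ι) (ρ σ τ : Finset ι → κ), (∀ S, ρ S ∈ t) → (∀ S, σ S ∈ t) →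
      (∀ S, τ S ∈ t) → (∀ S, σ S ≤ τ S) →
      ∑ S ∈ D'.powerset, wtW D' p S * ∑ T ∈ D'.powerset, ∑ U ∈ D'.powerset,
          wtW D' p T * wtW D' p U * (A (ρ S) (σ T) (τ U) + A (ρ S) (τ T) (σ U)) ≤
        ∑ S ∈ D'.powerset, wtW D' p S * ∑ T ∈ D'.powerset, ∑ U ∈ D'.powerset,
          wtW D' p T * wtW D' p U * (A (ρ S) (σ T) (σ U) + A (ρ S) (τ T) (τ U))) :
    ∀ π : Finset ι → κ, (∀ S, π S ∈ t) → (∀ ⦃x y : Finset ι⦄, x ⊆ y → π x ≤ π y) →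
      ∑ S ∈ D.powerset, ∑ T ∈ D.powerset, ∑ U ∈ D.powerset,
          wtW D p S * wtW D p T * wtW D p U * A (π S) (π T) (π U) ≤
        ∑ S ∈ D.powerset, wtW D p S * A (π S) (π S) (π S) := by
  induction D using Finset.induction_on with
  | empty =>
    intro π _ _
    simp [wtW]
  | @insert e D' he ih =>
    intro π hπt hπ
    have hq0 : 0 ≤ p e := hp0 e
    have hq1 : 0 ≤ 1 - p e := sub_nonneg.2 (hp1 e)
    have hπ₁mono : ∀ ⦃x y : Finset ι⦄, x ⊆ y → π (insert e x) ≤ π (insert e y) :=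
      fun x y hxy => hπ (Finset.insert_subset_insert e hxy)
    have hle : ∀ S, π S ≤ π (insert e S) := fun S => hπ (Finset.subset_insert e S)
    have hπ₁t : ∀ S, π (insert e S) ∈ t := fun S => hπt (insert e S)
    have hsplit1 : ∀ φ : Finset ι → ℝ,
        ∑ S ∈ (insert e D').powerset, wtW (insert e D') p S * φ S =
          (1 - p e) * ∑ S ∈ D'.powerset, wtW D' p S * φ S +
            p e * ∑ S ∈ D'.powerset, wtW D' p S * φ (insert e S) :=
      fun φ => sum_wtW_insert_split p he φ
    -- the 8 sections, indexed by Bool³ (true = upper section)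
    set lab : Bool → Finset ι → κ := fun b S => if b then π (insert e S) else π S with hlab
    set X : Bool → Bool → Bool → ℝ := fun b1 b2 b3 =>
      ∑ S ∈ D'.powerset, ∑ T ∈ D'.powerset, ∑ U ∈ D'.powerset,
        wtW D' p S * wtW D' p T * wtW D' p U * A (lab b1 S) (lab b2 T) (lab b3 U) with hX
    set q : ℝ := p e with hq
    set Y0 := ∑ S ∈ D'.powerset, wtW D' p S * A (π S) (π S) (π S) with hY0
    set Y1 := ∑ S ∈ D'.powerset, wtW D' p S * A (π (insert e S)) (π (insert e S)) (π (insert e S))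
      with hY1
    have hlabf : ∀ S, lab false S = π S := fun S => by simp [hlab]
    have hlabt : ∀ S, lab true S = π (insert e S) := fun S => by simp [hlab]
    -- generic: pull a scalar weight through a sum
    have hw : ∀ (c : ℝ) (f : Finset ι → ℝ), ∑ S ∈ D'.powerset, wtW D' p S * (c * f S) =
        c * ∑ S ∈ D'.powerset, wtW D' p S * f S := by
      intro c f; rw [Finset.mul_sum]; exact Finset.sum_congr rfl fun S _ => by ring
    -- decomposition of the three-copy side into the 8 sections
    have hL : ∑ S ∈ (insert e D').powerset, ∑ T ∈ (insert e D').powerset, ∑ U ∈ (insert e D').powerset,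
          wtW (insert e D') p S * wtW (insert e D') p T * wtW (insert e D') p U * A (π S) (π T) (π U) =
        (1 - q) * ((1 - q) * ((1 - q) * X false false false + q * X false false true) +
            q * ((1 - q) * X false true false + q * X false true true)) +
          q * ((1 - q) * ((1 - q) * X true false false + q * X true false true) +
            q * ((1 - q) * X true true false + q * X true true true)) := by
      -- innermost sum (U)
      have h3 : ∀ S T : Finset ι,
          ∑ U ∈ (insert e D').powerset, wtW (insert e D') p S * wtW (insert e D') p T *
              wtW (insert e D') p U * A (π S) (π T) (π U) =
            wtW (insert e D') p S * wtW (insert e D') p T *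
              ((1 - q) * ∑ U ∈ D'.powerset, wtW D' p U * A (π S) (π T) (π U) +
                q * ∑ U ∈ D'.powerset, wtW D' p U * A (π S) (π T) (π (insert e U))) := by
        intro S T
        rw [← hsplit1 (fun U => A (π S) (π T) (π U)), Finset.mul_sum]
        exact Finset.sum_congr rfl fun U _ => by ring
      simp only [h3]
      -- middle sum (T)
      have h2 : ∀ S : Finset ι,
          ∑ T ∈ (insert e D').powerset, wtW (insert e D') p S * wtW (insert e D') p T *
              ((1 - q) * ∑ U ∈ D'.powerset, wtW D' p U * A (π S) (π T) (π U) +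
                q * ∑ U ∈ D'.powerset, wtW D' p U * A (π S) (π T) (π (insert e U))) =
            wtW (insert e D') p S *
              ((1 - q) * ∑ T ∈ D'.powerset, wtW D' p T *
                  ((1 - q) * ∑ U ∈ D'.powerset, wtW D' p U * A (π S) (π T) (π U) +
                    q * ∑ U ∈ D'.powerset, wtW D' p U * A (π S) (π T) (π (insert e U))) +
                q * ∑ T ∈ D'.powerset, wtW D' p T *
                  ((1 - q) * ∑ U ∈ D'.powerset, wtW D' p U * A (π S) (π (insert e T)) (π U) +
                    q * ∑ U ∈ D'.powerset, wtW D' p U * A (π S) (π (insert e T)) (π (insert e U)))) := by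
        intro S
        rw [← hsplit1 (fun T => (1 - q) * ∑ U ∈ D'.powerset, wtW D' p U * A (π S) (π T) (π U) +
            q * ∑ U ∈ D'.powerset, wtW D' p U * A (π S) (π T) (π (insert e U))), Finset.mul_sum]
        exact Finset.sum_congr rfl fun T _ => by ring
      simp only [h2]
      -- outer sum (S)
      rw [hsplit1]
      -- expand both sides into sums of triple sums and normalise the scalar products
      simp only [hX, hlabf, hlabt, mul_add, Finset.mul_sum, Finset.sum_add_distrib]
      simp only [mul_assoc, mul_comm, mul_left_comm]
    -- decomposition of the diagonal side
    have hR : ∑ S ∈ (insert e D').powerset, wtW (insert e D') p S * A (π S) (π S) (π S) =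
        (1 - q) * Y0 + q * Y1 := hsplit1 (fun S => A (π S) (π S) (π S))
    -- symmetry collapses the sections: X depends only on the number of `true`s
    have hsymm : ∀ b1 b2 b3 : Bool, X b1 b2 b3 = X b2 b1 b3 ∧ X b1 b2 b3 = X b1 b3 b2 := by
      intro b1 b2 b3
      constructor
      · simp only [hX]
        rw [Finset.sum_comm]
        refine Finset.sum_congr rfl fun T _ => Finset.sum_congr rfl fun S _ =>
          Finset.sum_congr rfl fun U _ => ?_
        rw [hA12]; ring
      · simp only [hX]
        refine Finset.sum_congr rfl fun S _ => ?_
        rw [Finset.sum_comm]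
        refine Finset.sum_congr rfl fun U _ => Finset.sum_congr rfl fun T _ => ?_
        rw [hA23]; ring
    have e001 : X false false true = X true false false := by
      rw [(hsymm false false true).2, (hsymm false true false).1]
    have e010 : X false true false = X true false false := (hsymm false true false).1
    have e011 : X false true true = X true true false := by
      rw [(hsymm false true true).1, (hsymm true false true).2]
    have e101 : X true false true = X true true false := (hsymm true false true).2
    -- slice pair dominance with slot 1 = ρ: ρ = π (lower sections) and ρ = π ∘ insert e (upper sections)
    have hnorm : ∀ (ρ : Finset ι → κ) (f : κ → Finset ι → Finset ι → ℝ),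
        ∑ S ∈ D'.powerset, wtW D' p S * ∑ T ∈ D'.powerset, ∑ U ∈ D'.powerset,
            wtW D' p T * wtW D' p U * f (ρ S) T U =
          ∑ S ∈ D'.powerset, ∑ T ∈ D'.powerset, ∑ U ∈ D'.powerset,
            wtW D' p S * wtW D' p T * wtW D' p U * f (ρ S) T U := by
      intro ρ f
      refine Finset.sum_congr rfl fun S _ => ?_
      rw [Finset.mul_sum]
      refine Finset.sum_congr rfl fun T _ => ?_
      rw [Finset.mul_sum]
      exact Finset.sum_congr rfl fun U _ => by ring
    have hsplit_add : ∀ (f g : Finset ι → Finset ι → Finset ι → ℝ),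
        ∑ S ∈ D'.powerset, ∑ T ∈ D'.powerset, ∑ U ∈ D'.powerset,
            wtW D' p S * wtW D' p T * wtW D' p U * (f S T U + g S T U) =
          ∑ S ∈ D'.powerset, ∑ T ∈ D'.powerset, ∑ U ∈ D'.powerset,
              wtW D' p S * wtW D' p T * wtW D' p U * f S T U +
            ∑ S ∈ D'.powerset, ∑ T ∈ D'.powerset, ∑ U ∈ D'.powerset,
              wtW D' p S * wtW D' p T * wtW D' p U * g S T U := by
      intro f g
      rw [← Finset.sum_add_distrib]
      refine Finset.sum_congr rfl fun S _ => ?_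
      rw [← Finset.sum_add_distrib]
      refine Finset.sum_congr rfl fun T _ => ?_
      rw [← Finset.sum_add_distrib]
      exact Finset.sum_congr rfl fun U _ => by ring
    have hP0 : X false false true + X false true false ≤ X false false false + X false true true := by
      have h := hA D' π π (fun S => π (insert e S)) hπt hπt hπ₁t hle
      rw [hnorm π (fun y T U => A y (π T) (π (insert e U)) + A y (π (insert e T)) (π U)),
        hnorm π (fun y T U => A y (π T) (π U) + A y (π (insert e T)) (π (insert e U))),
        hsplit_add, hsplit_add] at h
      simp only [hX, hlabf, hlabt]
      linarith
    have hP1 : X true false true + X true true false ≤ X true false false + X true true true := by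
      have h := hA D' (fun S => π (insert e S)) π (fun S => π (insert e S)) hπ₁t hπt hπ₁t hle
      rw [hnorm (fun S => π (insert e S)) (fun y T U => A y (π T) (π (insert e U)) + A y (π (insert e T)) (π U)),
        hnorm (fun S => π (insert e S)) (fun y T U => A y (π T) (π U) + A y (π (insert e T)) (π (insert e U))),
        hsplit_add, hsplit_add] at h
      simp only [hX, hlabf, hlabt]
      linarith
    have hI0 : X false false false ≤ Y0 := by
      simp only [hX, hlabf]; exact ih π hπt (fun x y hxy => hπ hxy)
    have hI1 : X true true true ≤ Y1 := by
      simp only [hX, hlabt]; exact ih (fun S => π (insert e S)) hπ₁t hπ₁mono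
    rw [hL, hR, e001, e010, e011, e101]
    rw [e001, e010, e011] at hP0
    rw [e101] at hP1
    -- X1 := X true false false, X2 := X true true false
    have hq01 : 0 ≤ q * (1 - q) := mul_nonneg hq0 hq1
    have h2q : 0 ≤ 2 - q := by linarith [hp1 e]
    have h1q : 0 ≤ 1 + q := by linarith
    nlinarith [mul_le_mul_of_nonneg_left hI0 hq1, mul_le_mul_of_nonneg_left hI1 hq0,
      mul_le_mul_of_nonneg_left hP0 (mul_nonneg hq01 h2q),
      mul_le_mul_of_nonneg_left hP1 (mul_nonneg hq01 h1q)]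

/-! ### The checkable sufficient condition: per-slice Gram + nonnegative pair kernels -/

/-- **Slice pair dominance from per-slice Gram-plus-nonnegative decompositions.**  If for every slice
label `y ∈ t` the pair kernel of the 2-kernel `A(y,·,·)` on comparable pairs of `t` splits as
`A y a a' + A y b b' − A y a b' − A y b a' = Σ_{i<r} G y i a b · G y i a' b' + N y a b a' b'`, `N ≥ 0`,
then the slice pair-dominance hypothesis of `sum3_wtW_le_sum_wtW_diag3_of_slicePairDominance` holds
(per slice: a sum of squares plus a nonnegative sum, weighted by the nonnegative slice weights).
[cite: GladkovZimin2024HK, §4–§5] -/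
theorem slicePairDominance_of_gram {p : ι → ℝ} (hp0 : ∀ i, 0 ≤ p i) (hp1 : ∀ i, p i ≤ 1)
    {κ : Type*} [Preorder κ] (t : Finset κ) (A : κ → κ → κ → ℝ) (r : ℕ)
    (G : κ → Fin r → κ → κ → ℝ) (N : κ → κ → κ → κ → κ → ℝ)
    (hN : ∀ y a b a' b', y ∈ t → a ∈ t → b ∈ t → a' ∈ t → b' ∈ t → a ≤ b → a' ≤ b' →
      0 ≤ N y a b a' b')
    (hK : ∀ y a b a' b', y ∈ t → a ∈ t → b ∈ t → a' ∈ t → b' ∈ t → a ≤ b → a' ≤ b' →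
      A y a a' + A y b b' - A y a b' - A y b a' = ∑ i : Fin r, G y i a b * G y i a' b' + N y a b a' b')
    (D' : Finset ι) (ρ σ τ : Finset ι → κ) (hρ : ∀ S, ρ S ∈ t) (hσ : ∀ S, σ S ∈ t)
    (hτ : ∀ S, τ S ∈ t) (hστ : ∀ S, σ S ≤ τ S) :
    ∑ S ∈ D'.powerset, wtW D' p S * ∑ T ∈ D'.powerset, ∑ U ∈ D'.powerset,
        wtW D' p T * wtW D' p U * (A (ρ S) (σ T) (τ U) + A (ρ S) (τ T) (σ U)) ≤
      ∑ S ∈ D'.powerset, wtW D' p S * ∑ T ∈ D'.powerset, ∑ U ∈ D'.powerset,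
        wtW D' p T * wtW D' p U * (A (ρ S) (σ T) (σ U) + A (ρ S) (τ T) (τ U)) := by
  refine Finset.sum_le_sum fun S _ => mul_le_mul_of_nonneg_left ?_ (wtW_nonneg D' hp0 hp1 S)
  -- degree-2 argument for the slice `y = ρ S`
  set y := ρ S with hy
  set P := D'.powerset with hP
  set w : Finset ι → ℝ := fun S => wtW D' p S with hw
  set g : Fin r → Finset ι → ℝ := fun i T => G y i (σ T) (τ T) with hg
  set n : Finset ι → Finset ι → ℝ := fun T U => N y (σ T) (τ T) (σ U) (τ U) with hn
  have hw0 : ∀ S, 0 ≤ w S := fun S => wtW_nonneg D' hp0 hp1 S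
  rw [← sub_nonneg, ← Finset.sum_sub_distrib]
  have hrw : ∀ T ∈ P,
      (∑ U ∈ P, wtW D' p T * wtW D' p U * (A y (σ T) (σ U) + A y (τ T) (τ U)) -
        ∑ U ∈ P, wtW D' p T * wtW D' p U * (A y (σ T) (τ U) + A y (τ T) (σ U))) =
      ∑ U ∈ P, (∑ i : Fin r, (w T * g i T) * (w U * g i U)) + ∑ U ∈ P, w T * w U * n T U := by
    intro T _
    rw [← Finset.sum_sub_distrib, ← Finset.sum_add_distrib]
    refine Finset.sum_congr rfl fun U _ => ?_
    have hk := hK y (σ T) (τ T) (σ U) (τ U) (hρ S) (hσ T) (hτ T) (hσ U) (hτ U) (hστ T) (hστ U)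
    have e1 : wtW D' p T * wtW D' p U * (A y (σ T) (σ U) + A y (τ T) (τ U)) -
        wtW D' p T * wtW D' p U * (A y (σ T) (τ U) + A y (τ T) (σ U)) =
        w T * w U * (A y (σ T) (σ U) + A y (τ T) (τ U) - A y (σ T) (τ U) - A y (τ T) (σ U)) := by
      simp only [hw]; ring
    rw [e1, hk, mul_add, Finset.mul_sum]
    congr 1
    exact Finset.sum_congr rfl fun i _ => by simp only [hg]; ring
  rw [Finset.sum_congr rfl hrw, Finset.sum_add_distrib]
  refine add_nonneg ?_ ?_
  · have hcomm : ∑ T ∈ P, ∑ U ∈ P, ∑ i : Fin r, (w T * g i T) * (w U * g i U) =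
        ∑ i : Fin r, (∑ T ∈ P, w T * g i T) * (∑ U ∈ P, w U * g i U) := by
      rw [Finset.sum_comm]
      have h2 : ∀ U ∈ P, ∑ T ∈ P, ∑ i : Fin r, (w T * g i T) * (w U * g i U) =
          ∑ i : Fin r, ∑ T ∈ P, (w T * g i T) * (w U * g i U) := fun U _ => Finset.sum_comm
      rw [Finset.sum_congr rfl h2, Finset.sum_comm]
      refine Finset.sum_congr rfl fun i _ => ?_
      rw [Finset.sum_mul_sum, Finset.sum_comm]
    rw [hcomm]
    exact Finset.sum_nonneg fun i _ => by
      have : (∑ T ∈ P, w T * g i T) * (∑ U ∈ P, w U * g i U) = (∑ T ∈ P, w T * g i T) ^ 2 := by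
        rw [sq]
      rw [this]; exact sq_nonneg _
  · exact Finset.sum_nonneg fun T _ => Finset.sum_nonneg fun U _ =>
      mul_nonneg (mul_nonneg (hw0 T) (hw0 U))
        (by simp only [hn]; exact hN _ _ _ _ _ (hρ S) (hσ T) (hτ T) (hσ U) (hτ U) (hστ T) (hστ U))

/-! ### The row on the label law -/

/-- A weighted sum of a function of the label is the sum over labels against the fibre masses
(local copy). [folklore] -/
private theorem sum_wtW_comp_eq_sum_fiber (D : Finset ι) (p : ι → ℝ) {κ : Type*} [DecidableEq κ]
    (π : Finset ι → κ) (t : Finset κ) (ht : ∀ S ∈ D.powerset, π S ∈ t) (φ : κ → ℝ) :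
    ∑ S ∈ D.powerset, wtW D p S * φ (π S) = ∑ a ∈ t, φ a * PrW D p {S | π S = a} := by
  have hfib : ∀ a : κ, PrW D p {S | π S = a} = ∑ S ∈ D.powerset with π S = a, wtW D p S := by
    intro a
    unfold PrW
    rw [Finset.sum_filter]
    refine Finset.sum_congr rfl fun S _ => ?_
    by_cases h : π S = a
    · rw [if_pos h, Set.indicator_of_mem (by exact h)]
    · rw [if_neg h, Set.indicator_of_notMem (by exact h)]
  simp only [hfib]
  rw [← Finset.sum_fiberwise_of_maps_to ht]
  refine Finset.sum_congr rfl fun a _ => ?_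
  rw [Finset.mul_sum]
  refine Finset.sum_congr rfl fun S hS => ?_
  rw [(Finset.mem_filter.1 hS).2, mul_comm]

/-- **Degree-3 lift, row form on the label law.**  With `x_a = PrW D p {S | π S = a}` the law of a
monotone `t`-valued labelling `π`, and a symmetric cubic kernel `A` whose slice pair kernels on comparable
pairs of `t` are Gram + nonnegative (`hK`, `hN`):
`Σ_{a,b,c ∈ t} A a b c · x_a x_b x_c ≤ Σ_{a ∈ t} A a a a · x_a`  (on the simplex `Σ x = 1` this is
`⟨A, diag₃(x) − x^{⊗3}⟩ ≥ 0`, the dual form of the degree-3 lift).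
[cite: GladkovZimin2024HK, §5 Thm. 5.1 (k = 3; proof supplied here)] -/
theorem cubicKernel_PrW_fiber_le_of_gram (D : Finset ι) {p : ι → ℝ} (hp0 : ∀ i, 0 ≤ p i)
    (hp1 : ∀ i, p i ≤ 1) {κ : Type*} [Preorder κ] [DecidableEq κ] (π : Finset ι → κ)
    (hπ : ∀ ⦃x y : Finset ι⦄, x ⊆ y → π x ≤ π y) (t : Finset κ) (ht : ∀ S, π S ∈ t)
    (A : κ → κ → κ → ℝ) (hA12 : ∀ a b c, A a b c = A b a c) (hA23 : ∀ a b c, A a b c = A a c b)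
    (r : ℕ) (G : κ → Fin r → κ → κ → ℝ) (N : κ → κ → κ → κ → κ → ℝ)
    (hN : ∀ y a b a' b', y ∈ t → a ∈ t → b ∈ t → a' ∈ t → b' ∈ t → a ≤ b → a' ≤ b' →
      0 ≤ N y a b a' b')
    (hK : ∀ y a b a' b', y ∈ t → a ∈ t → b ∈ t → a' ∈ t → b' ∈ t → a ≤ b → a' ≤ b' →
      A y a a' + A y b b' - A y a b' - A y b a' = ∑ i : Fin r, G y i a b * G y i a' b' + N y a b a' b') :
    ∑ a ∈ t, ∑ b ∈ t, ∑ c ∈ t, A a b c *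
        (PrW D p {S | π S = a} * PrW D p {S | π S = b} * PrW D p {S | π S = c}) ≤
      ∑ a ∈ t, A a a a * PrW D p {S | π S = a} := by
  have ht' : ∀ S ∈ D.powerset, π S ∈ t := fun S _ => ht S
  have h := sum3_wtW_le_sum_wtW_diag3_of_slicePairDominance D hp0 hp1 t A hA12 hA23
    (fun D' ρ σ τ hρ hσ hτ hστ =>
      slicePairDominance_of_gram hp0 hp1 t A r G N hN hK D' ρ σ τ hρ hσ hτ hστ) π ht hπ
  -- diagonal side
  rw [sum_wtW_comp_eq_sum_fiber D p π t ht' (fun a => A a a a)] at h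
  -- three-copy side: innermost first
  have hU : ∀ S T : Finset ι, ∑ U ∈ D.powerset, wtW D p S * wtW D p T * wtW D p U * A (π S) (π T) (π U) =
      wtW D p S * wtW D p T * ∑ c ∈ t, A (π S) (π T) c * PrW D p {V | π V = c} := by
    intro S T
    rw [← sum_wtW_comp_eq_sum_fiber D p π t ht' (fun c => A (π S) (π T) c), Finset.mul_sum]
    exact Finset.sum_congr rfl fun U _ => by ring
  have hT : ∀ S : Finset ι, ∑ T ∈ D.powerset, wtW D p S * wtW D p T *
        ∑ c ∈ t, A (π S) (π T) c * PrW D p {V | π V = c} =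
      wtW D p S * ∑ b ∈ t, (∑ c ∈ t, A (π S) b c * PrW D p {V | π V = c}) * PrW D p {V | π V = b} := by
    intro S
    rw [← sum_wtW_comp_eq_sum_fiber D p π t ht' (fun b => ∑ c ∈ t, A (π S) b c * PrW D p {V | π V = c}),
      Finset.mul_sum]
    exact Finset.sum_congr rfl fun T _ => by ring
  simp only [hU] at h
  simp only [hT] at h
  rw [sum_wtW_comp_eq_sum_fiber D p π t ht'
    (fun a => ∑ b ∈ t, (∑ c ∈ t, A a b c * PrW D p {V | π V = c}) * PrW D p {V | π V = b})] at h
  calc ∑ a ∈ t, ∑ b ∈ t, ∑ c ∈ t, A a b c *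
        (PrW D p {S | π S = a} * PrW D p {S | π S = b} * PrW D p {S | π S = c})
      = ∑ a ∈ t, (∑ b ∈ t, (∑ c ∈ t, A a b c * PrW D p {V | π V = c}) * PrW D p {V | π V = b}) *
          PrW D p {S | π S = a} := by
        refine Finset.sum_congr rfl fun a _ => ?_
        rw [Finset.sum_mul]
        refine Finset.sum_congr rfl fun b _ => ?_
        rw [Finset.sum_mul, Finset.sum_mul]
        exact Finset.sum_congr rfl fun c _ => by ring
    _ ≤ ∑ a ∈ t, A a a a * PrW D p {S | π S = a} := h

end DecisionTree

end Literature.Probability.Percolation
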